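import Summits.AtomisticToContinuum.HydrodynamicLimit.Theorems.BandCoherenceLDAlongFamilies.Negative.GibbsWindow
import HarnessLib

/-!
# Band-coherence drift witness, IV: the exponential-moment lower bound (entropy inequality against the boosted Gibbs law)

Negative knowledge for the crux `OneFlightGossipEngine.BandCoherenceLDAlongFamilies` (stmt-AtomisticToContinuum-17700):
the GALILEAN-DRIFT WITNESS of refuter-rattack-stmt-AtomisticToContinuum-17700-0 (item evidence WITNESS.md).  The tested
band-coherence functional `S = Σᵢ 1{η cubᵢ < ‖q̄ᵢ‖} cubBandᵢ` has a non-zero LINEAR response to a uniform boost `D e₀` of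
the homogeneous reference law, whose relative-entropy cost `(N+1)D²/2` is QUADRATIC, while the statement demands the
exponential moment at the FIXED tilt `(8Θ̄K₁)⁻¹` to be `≤ e^{ε(N+1)}` for every `ε > 0`.  No Theses declaration is asserted
positively in this file (pure helper theorems, no definitions).

This file (§7, `main_bound`): for `σ ≤ 1/2`, EVERY `N`, EVERY hard-sphere flow `Φ`, EVERY window `w > 0`, band `0 < k ≤ K`,
`η ≥ 0`, tilt `λ ≥ 0` and boost `0 ≤ D ≤ 1`,
`∫ exp(λ S) dG₀ ≥ exp((N+1)[λ(5D − k²D − k³ − M/K³ − η(1+M)) − D²/2])`,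
where `S` is the band-coherence functional of `BandCoherenceLDAlongFamilies` at `u₀ = 0`, `θ₀ = Θ̄ = a = 1` with the witness
weight.  Proof: `dG₀ = e^{−ℓ_D} dG_D` (III), pathwise `S ≥ S_lin := Σᵢ (q̄ᵢ₀ − η cubᵢ)` on the good set (I), tangent-line
Jensen `e^X ≥ e^c(1 + X − c)` under the probability law `G_D` with `X = λ S_lin − ℓ_D`, `c = E X`, and the static means of
III + the Gaussian bounds of II: `E_{G_D} q̄ᵢ₀ = E_{N(De₀,id)}[R(‖v‖²)v₀]`, `E cubᵢ = E‖v‖³`, `E ℓ_D = (N+1)D²/2`.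

References: S. Olla, S. R. S. Varadhan, H.-T. Yau, Comm. Math. Phys. 155 (1993) §2; C. Kipnis, C. Landim (1999) App. 1 §8
(entropy inequality).
-/

noncomputable section

open MeasureTheory ProbabilityTheory Set Filter Topology
open scoped ENNReal InnerProductSpace BigOperators

namespace Summit.AtomisticToContinuum.HydrodynamicLimit.Theorems

namespace BandCoherenceLDNegative

open Literature.MathematicalPhysics.KineticTheory Literature.Analysis.FluidPDE

/-! ## §7 The exponential-moment lower bound under the zero-drift homogeneous Gibbs law -/

section Main

variable {σ : ℝ}

/-- **MAIN LOWER BOUND (entropy inequality against the boosted Gibbs law).** For `σ ≤ 1/2`, EVERY `N`, EVERY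
hard-sphere flow, EVERY window `w > 0`, band `0 < k ≤ K`, `η ≥ 0`, tilt `λ ≥ 0` and boost `0 ≤ D ≤ 1`:
`∫ exp(λ S) dG₀ ≥ exp((N+1)[λ(5D − k²D − k³ − M/K³ − η(1+M)) − D²/2])`, where `S` is the band-coherence functional of
`BandCoherenceLDAlongFamilies` at `u₀ = 0`, `θ₀ = Θ̄ = a = 1` and the witness weight `R = Rrad k K`. [folklore] -/
theorem main_bound (hσ2 : σ ≤ 1 / 2) (N : ℕ) (Φ : HardSphereFlow (Torus.geometry (Fin 3)) (hsDiameter σ N) (N + 1))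
    {w : ℝ} (hw : 0 < w) {k K : ℝ} (hk : 0 < k) (hkK : k ≤ K) {η : ℝ} (hη : 0 ≤ η) {lam : ℝ} (hlam : 0 ≤ lam)
    {D : ℝ} (hD0 : 0 ≤ D) (hD1 : D ≤ 1) :
    ENNReal.ofReal (Real.exp (((N : ℝ) + 1) *
        (lam * (5 * D - k ^ 2 * D - k ^ 3 - (∫ w, (1 + ‖w‖) ^ 6 ∂stdGaussian V3) / K ^ 3 - η * (1 + (∫ w, (1 + ‖w‖) ^ 6 ∂stdGaussian V3))) - D ^ 2 / 2))) ≤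
      ∫⁻ z, ENNReal.ofReal (Real.exp (lam * ∑ i : Fin (N + 1),
        (if η * (w⁻¹ * ∫ r in (0 : ℝ)..w, ‖(Φ.flow r z i).2‖ ^ 3) <
            ‖w⁻¹ • ∫ r in (0 : ℝ)..w, ((if k ^ 2 < ‖(Φ.flow r z i).2‖ ^ 2 ∧ ‖(Φ.flow r z i).2‖ ^ 2 ≤ K ^ 2 then ‖(Φ.flow r z i).2‖ ^ 2 - k ^ 2 else 0)) • (Φ.flow r z i).2‖ then
          w⁻¹ * ∫ r in (0 : ℝ)..w,
            (if k < ‖(Φ.flow r z i).2‖ ∧ ‖(Φ.flow r z i).2‖ ≤ K then ‖(Φ.flow r z i).2‖ ^ 3 else 0)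
          else 0)))
        ∂(localGibbsLaw σ (fun _ => (1 : ℝ)) (fun _ => (0 : V3)) (fun _ => (1 : ℝ)) N Φ) := by
  have hK : 0 < K := hk.trans_le hkK
  -- change of measure to the boosted Gibbs law
  have hmE : Measurable fun z : Config (N + 1) (Fin 3) T3 => ENNReal.ofReal (Real.exp (-(∑ j, (D * (z j).2 0 - D ^ 2 / 2)))) :=
    (Real.continuous_exp.comp (continuous_ell D (N + 1)).neg).measurable.ennreal_ofReal
  rw [localGibbsLaw_zero_eq_withDensity σ N Φ D,
    lintegral_withDensity_eq_lintegral_mul_non_measurable _ hmE (ae_of_all _ fun z => ENNReal.ofReal_lt_top)]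
  set Q := localGibbsLaw σ (fun _ => (1 : ℝ)) (fun _ => D • (EuclideanSpace.single (0 : Fin 3) (1 : ℝ) : V3)) (fun _ => (1 : ℝ)) N Φ with hQ
  haveI : IsProbabilityMeasure Q := isProbabilityMeasure_localGibbsLaw continuous_const continuous_const
    continuous_const (fun _ => one_pos) (fun _ => one_pos) hσ2 N Φ
  have hgood : Q Φ.goodᶜ = 0 :=
    (withDensity_absolutelyContinuous _ _ : Q ≪ liouville (Torus.geometry (Fin 3)) (N + 1) (hsDiameter σ N))
      Φ.measure_compl_good
  have hae : ∀ᵐ z ∂Q, z ∈ Φ.good := by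
    rw [ae_iff]
    exact hgood
  -- abbreviations
  set S : Config (N + 1) (Fin 3) T3 → ℝ := fun z => ∑ i : Fin (N + 1),
        (if η * (w⁻¹ * ∫ r in (0 : ℝ)..w, ‖(Φ.flow r z i).2‖ ^ 3) <
            ‖w⁻¹ • ∫ r in (0 : ℝ)..w, ((if k ^ 2 < ‖(Φ.flow r z i).2‖ ^ 2 ∧ ‖(Φ.flow r z i).2‖ ^ 2 ≤ K ^ 2 then ‖(Φ.flow r z i).2‖ ^ 2 - k ^ 2 else 0)) • (Φ.flow r z i).2‖ then
          w⁻¹ * ∫ r in (0 : ℝ)..w,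
            (if k < ‖(Φ.flow r z i).2‖ ∧ ‖(Φ.flow r z i).2‖ ≤ K then ‖(Φ.flow r z i).2‖ ^ 3 else 0)
          else 0) with hS
  set h : Fin (N + 1) → Config (N + 1) (Fin 3) T3 → ℝ := fun i z' => (if k ^ 2 < ‖(z' i).2‖ ^ 2 ∧ ‖(z' i).2‖ ^ 2 ≤ K ^ 2 then ‖(z' i).2‖ ^ 2 - k ^ 2 else 0) * (z' i).2 0 with hh
  set Tq : Fin (N + 1) → Config (N + 1) (Fin 3) T3 → ℝ := fun i z =>
    w⁻¹ * ∫ r in (0 : ℝ)..w, h i (Φ.flow r z) with hTq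
  set cubF : Fin (N + 1) → Config (N + 1) (Fin 3) T3 → ℝ := fun i z =>
    w⁻¹ * ∫ r in (0 : ℝ)..w, ‖(Φ.flow r z i).2‖ ^ 3 with hcubF
  set Slin : Config (N + 1) (Fin 3) T3 → ℝ := fun z => ∑ i, (Tq i z - η * cubF i z) with hSlin
  set X : Config (N + 1) (Fin 3) T3 → ℝ := fun z => lam * Slin z - (∑ j, (D * (z j).2 0 - D ^ 2 / 2)) with hX
  set γ₀ : ℝ := ∫ v, (if k ^ 2 < ‖v‖ ^ 2 ∧ ‖v‖ ^ 2 ≤ K ^ 2 then ‖v‖ ^ 2 - k ^ 2 else 0) * v 0 ∂gaussMeasure (D • (EuclideanSpace.single (0 : Fin 3) (1 : ℝ) : V3)) 1 with hγ₀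
  set C₃ : ℝ := ∫ v, ‖v‖ ^ 3 ∂gaussMeasure (D • (EuclideanSpace.single (0 : Fin 3) (1 : ℝ) : V3)) 1 with hC₃
  -- (F1) pathwise domination on the good set
  have hF1 : ∀ z ∈ Φ.good, Slin z ≤ S z := by
    intro z hz
    simp only [hSlin, hS, hTq, hcubF, hh]
    refine Finset.sum_le_sum fun i _ => ?_
    have hWm : Measurable fun r => (Φ.flow r z i).2 := Φ.measurable_vel_orbit hz i
    exact linear_le_summand (W := fun r => (Φ.flow r z i).2) hw hk.le hK.le hη hWm
  -- (F2) the linear drift functional: bounded window average of the bounded one-body `h i`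
  have hhm : ∀ i, Measurable (h i) := fun i =>
    ((measurable_Rrad k K).comp ((measurable_pi_apply i).snd.norm.pow_const 2)).mul
      ((EuclideanSpace.proj (𝕜 := ℝ) (0 : Fin 3)).measurable.comp (measurable_pi_apply i).snd)
  have hhb : ∀ i z', |h i z'| ≤ K ^ 3 := fun i z' => abs_Rrad_mul_coord_le hk.le hK.le _
  have hTq_bd : ∀ i z, |Tq i z| ≤ K ^ 3 := by
    intro i z
    simp only [hTq]
    rw [abs_mul, abs_of_pos (inv_pos.2 hw)]
    have h1 : ‖∫ r in (0 : ℝ)..w, h i (Φ.flow r z)‖ ≤ K ^ 3 * |w - 0| :=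
      intervalIntegral.norm_integral_le_of_norm_le_const fun r _ => by
        rw [Real.norm_eq_abs]; exact hhb i _
    rw [Real.norm_eq_abs, sub_zero, abs_of_pos hw] at h1
    calc w⁻¹ * |∫ r in (0 : ℝ)..w, h i (Φ.flow r z)| ≤ w⁻¹ * (K ^ 3 * w) :=
          mul_le_mul_of_nonneg_left h1 (inv_pos.2 hw).le
      _ = K ^ 3 := by field_simp
  have hTq_int : ∀ i, Integrable (Tq i) Q := fun i =>
    Integrable.of_bound ((Φ.aemeasurable_intervalIntegral_comp_flow_torus (hhm i) 0 w hgood).const_mul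
      w⁻¹).aestronglyMeasurable (K ^ 3) (ae_of_all _ fun z => by rw [Real.norm_eq_abs]; exact hTq_bd i z)
  have hTq_val : ∀ i, ∫ z, Tq i z ∂Q = γ₀ := by
    intro i
    simp only [hTq, hγ₀]
    rw [integral_windowAvg_eq hσ2 (D • (EuclideanSpace.single (0 : Fin 3) (1 : ℝ) : V3)) N Φ (hhm i) (hhb i) hw]
    exact integral_vel_localGibbsLaw one_pos one_pos (D • (EuclideanSpace.single (0 : Fin 3) (1 : ℝ) : V3)) hσ2 N Φ i
      (g := fun v => (if k ^ 2 < ‖v‖ ^ 2 ∧ ‖v‖ ^ 2 ≤ K ^ 2 then ‖v‖ ^ 2 - k ^ 2 else 0) * v 0)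
      (((measurable_Rrad k K).comp (measurable_norm.pow_const 2)).mul
        (EuclideanSpace.proj (𝕜 := ℝ) (0 : Fin 3)).measurable).aestronglyMeasurable
  -- (F3) the cube
  have hcub : ∀ i, Integrable (cubF i) Q ∧ ∫ z, cubF i z ∂Q = C₃ := by
    intro i
    obtain ⟨hI, hIv⟩ := integrable_windowCube hσ2 (D • (EuclideanSpace.single (0 : Fin 3) (1 : ℝ) : V3)) N Φ i hw
    refine ⟨hI.const_mul w⁻¹, ?_⟩
    simp only [hcubF, hC₃]
    rw [integral_const_mul, hIv, ← mul_assoc, inv_mul_cancel₀ hw.ne', one_mul]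
  -- (F4) the log-density
  have hv0_int : ∀ i, Integrable (fun z : Config (N + 1) (Fin 3) T3 => (z i).2 0) Q := fun i =>
    (integrable_vel_localGibbsLaw_iff one_pos one_pos (D • (EuclideanSpace.single (0 : Fin 3) (1 : ℝ) : V3)) hσ2 N Φ i (g := fun v : V3 => v 0)
      (EuclideanSpace.proj (𝕜 := ℝ) (0 : Fin 3)).continuous.aestronglyMeasurable).2
      (memLp_one_iff_integrable.1 (memLp_coord_gaussMeasure (D • (EuclideanSpace.single (0 : Fin 3) (1 : ℝ) : V3)) 1 0 1 (by simp)))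
  have hv0_val : ∀ i, ∫ z : Config (N + 1) (Fin 3) T3, (z i).2 0 ∂Q = D := fun i => by
    rw [integral_vel_localGibbsLaw one_pos one_pos (D • (EuclideanSpace.single (0 : Fin 3) (1 : ℝ) : V3)) hσ2 N Φ i (g := fun v : V3 => v 0)
      (EuclideanSpace.proj (𝕜 := ℝ) (0 : Fin 3)).continuous.aestronglyMeasurable]
    exact integral_coord_gaussD D
  have hell_int : Integrable (fun z : Config (N + 1) (Fin 3) T3 => (∑ j, (D * (z j).2 0 - D ^ 2 / 2))) Q := by
    exact integrable_finsetSum _ fun i _ => ((hv0_int i).const_mul D).sub' (integrable_const _)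
  have hell_val : ∫ z, (∑ j, (D * (z j).2 0 - D ^ 2 / 2)) ∂Q = ((N : ℝ) + 1) * (D ^ 2 / 2) := by
    rw [integral_finsetSum _ fun i _ => ((hv0_int i).const_mul D).sub' (integrable_const _)]
    have : ∀ i : Fin (N + 1), ∫ z : Config (N + 1) (Fin 3) T3, (D * (z i).2 0 - D ^ 2 / 2) ∂Q = D ^ 2 / 2 := by
      intro i
      rw [integral_sub ((hv0_int i).const_mul D) (integrable_const _), integral_const_mul, hv0_val i,
        integral_const]
      simp; ring
    simp_rw [this]
    rw [Finset.sum_const, Finset.card_univ, Fintype.card_fin, nsmul_eq_mul]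
    push_cast
    ring
  -- the exponent `X = λ S_lin − ℓ` and its mean
  have hSlin_int : Integrable Slin Q :=
    integrable_finsetSum _ fun i _ => (hTq_int i).sub' ((hcub i).1.const_mul η)
  have hSlin_val : ∫ z, Slin z ∂Q = ((N : ℝ) + 1) * (γ₀ - η * C₃) := by
    simp only [hSlin]
    rw [integral_finsetSum _ fun i _ => (hTq_int i).sub' ((hcub i).1.const_mul η)]
    have : ∀ i : Fin (N + 1), ∫ z, (Tq i z - η * cubF i z) ∂Q = γ₀ - η * C₃ := by
      intro i
      rw [integral_sub (hTq_int i) ((hcub i).1.const_mul η), hTq_val i, integral_const_mul, (hcub i).2]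
    simp_rw [this]
    rw [Finset.sum_const, Finset.card_univ, Fintype.card_fin, nsmul_eq_mul]
    push_cast
    ring
  have hX_int : Integrable X Q := (hSlin_int.const_mul lam).sub' hell_int
  have hX_val : ∫ z, X z ∂Q = lam * (((N : ℝ) + 1) * (γ₀ - η * C₃)) - ((N : ℝ) + 1) * (D ^ 2 / 2) := by
    simp only [hX]
    rw [integral_sub (hSlin_int.const_mul lam) hell_int, integral_const_mul, hSlin_val, hell_val]
  -- (F5) the Gaussian bounds
  have hc_lower : ((N : ℝ) + 1) * (lam * (5 * D - k ^ 2 * D - k ^ 3 - (∫ w, (1 + ‖w‖) ^ 6 ∂stdGaussian V3) / K ^ 3 - η * (1 + (∫ w, (1 + ‖w‖) ^ 6 ∂stdGaussian V3))) - D ^ 2 / 2) ≤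
      ∫ z, X z ∂Q := by
    have h1 := gamma_lower hD0 hk.le hkK hK
    have hM6 := integral_norm_pow_six_gaussD_le hD0 hD1
    have hdiv : (∫ v, ‖v‖ ^ 6 ∂gaussMeasure (D • (EuclideanSpace.single (0 : Fin 3) (1 : ℝ) : V3)) 1) / K ^ 3 ≤ (∫ w, (1 + ‖w‖) ^ 6 ∂stdGaussian V3) / K ^ 3 :=
      div_le_div_of_nonneg_right hM6 (pow_pos hK 3).le
    have h2 : η * C₃ ≤ η * (1 + (∫ w, (1 + ‖w‖) ^ 6 ∂stdGaussian V3)) := mul_le_mul_of_nonneg_left (integral_norm_pow_three_gaussD_le hD0 hD1) hη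
    have hbr : 5 * D - k ^ 2 * D - k ^ 3 - (∫ w, (1 + ‖w‖) ^ 6 ∂stdGaussian V3) / K ^ 3 - η * (1 + (∫ w, (1 + ‖w‖) ^ 6 ∂stdGaussian V3)) ≤ γ₀ - η * C₃ := by
      rw [hγ₀]; linarith
    have h3 : lam * (5 * D - k ^ 2 * D - k ^ 3 - (∫ w, (1 + ‖w‖) ^ 6 ∂stdGaussian V3) / K ^ 3 - η * (1 + (∫ w, (1 + ‖w‖) ^ 6 ∂stdGaussian V3))) ≤ lam * (γ₀ - η * C₃) :=
      mul_le_mul_of_nonneg_left hbr hlam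
    have hN : (0 : ℝ) ≤ (N : ℝ) + 1 := by positivity
    rw [hX_val]
    nlinarith [mul_le_mul_of_nonneg_left h3 hN]
  -- (F6) tangent-line Jensen under `Q`
  set c : ℝ := ∫ z, X z ∂Q with hc
  set Y : Config (N + 1) (Fin 3) T3 → ℝ := fun z => Real.exp c * (1 + (X z - c)) with hY
  have hY_int : Integrable Y Q :=
    ((integrable_const (1 : ℝ)).fun_add (hX_int.sub' (integrable_const c))).const_mul _
  have hY_val : ∫ z, Y z ∂Q = Real.exp c := by
    simp only [hY]
    rw [integral_const_mul, integral_add (integrable_const _) (hX_int.sub' (integrable_const c)),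
      integral_sub hX_int (integrable_const c), integral_const, integral_const, ← hc]
    simp
  have hpt : ∀ z ∈ Φ.good, ENNReal.ofReal (Y z) ≤
      ENNReal.ofReal (Real.exp (-(∑ j, (D * (z j).2 0 - D ^ 2 / 2)))) * ENNReal.ofReal (Real.exp (lam * S z)) := by
    intro z hz
    rw [← ENNReal.ofReal_mul (Real.exp_pos _).le, ← Real.exp_add]
    refine ENNReal.ofReal_le_ofReal ?_
    have h1 : Y z ≤ Real.exp c * Real.exp (X z - c) :=
      mul_le_mul_of_nonneg_left (by linarith [Real.add_one_le_exp (X z - c)]) (Real.exp_pos c).le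
    rw [← Real.exp_add] at h1
    refine h1.trans (Real.exp_le_exp.2 ?_)
    have h2 : lam * Slin z ≤ lam * S z := mul_le_mul_of_nonneg_left (hF1 z hz) hlam
    simp only [hX]
    linarith
  calc ENNReal.ofReal (Real.exp (((N : ℝ) + 1) *
          (lam * (5 * D - k ^ 2 * D - k ^ 3 - (∫ w, (1 + ‖w‖) ^ 6 ∂stdGaussian V3) / K ^ 3 - η * (1 + (∫ w, (1 + ‖w‖) ^ 6 ∂stdGaussian V3))) - D ^ 2 / 2)))
      ≤ ENNReal.ofReal (Real.exp c) := ENNReal.ofReal_le_ofReal (Real.exp_le_exp.2 hc_lower)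
    _ = ENNReal.ofReal (∫ z, Y z ∂Q) := by rw [hY_val]
    _ ≤ ∫⁻ z, ENNReal.ofReal (Y z) ∂Q := by
        -- `ofReal (∫ Y) ≤ ∫⁻ ofReal Y` through the positive part of `Y`
        have h1 : ∫ z, Y z ∂Q ≤ ∫ z, max (Y z) 0 ∂Q := integral_mono hY_int hY_int.pos_part fun z => le_max_left _ _
        have h2 : ENNReal.ofReal (∫ z, max (Y z) 0 ∂Q) = ∫⁻ z, ENNReal.ofReal (max (Y z) 0) ∂Q :=
          ofReal_integral_eq_lintegral_ofReal hY_int.pos_part (ae_of_all _ fun z => le_max_right _ _)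
        have h3 : ∀ z, ENNReal.ofReal (max (Y z) 0) = ENNReal.ofReal (Y z) := fun z => by
          rcases le_total (Y z) 0 with h | h
          · rw [max_eq_right h, ENNReal.ofReal_zero, ENNReal.ofReal_of_nonpos h]
          · rw [max_eq_left h]
        calc ENNReal.ofReal (∫ z, Y z ∂Q) ≤ ENNReal.ofReal (∫ z, max (Y z) 0 ∂Q) := ENNReal.ofReal_le_ofReal h1
          _ = ∫⁻ z, ENNReal.ofReal (Y z) ∂Q := by rw [h2]; exact lintegral_congr h3
    _ ≤ _ := lintegral_mono_ae (by
        filter_upwards [hae] with z hz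
        exact hpt z hz)

end Main

end BandCoherenceLDNegative

end Summit.AtomisticToContinuum.HydrodynamicLimit.Theorems

end
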